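import Literature.MathematicalPhysics.QuantumFieldTheory.BalabanImbrieJaffe1984to88.BIJ88WalkForm5133
import Literature.MathematicalPhysics.QuantumFieldTheory.BalabanImbrieJaffe1984to88.BIJ88ProductRuleAllOrders306
import Mathlib.Data.Prod.Lex

/-!
# `BalabanImbrieJaffe1984to88.BIJ88TrainsDsetExpansion306` — T. Bałaban, J. Imbrie, A. Jaffe, *Effective action and cluster properties of
the abelian Higgs model*, Commun. Math. Phys. **114** (1988) 257–315 [BalabanImbrieJaffe1988]: p. 306 [PDF 50] (Sect. 5.13) — **THE PRODUCT OF
TRAINS AS A SUM OVER THEIR ENDS OF ITERATED COORDINATE DERIVATIVES**.  Print, (5.13.3) p. 306: *"⟨Π_{i∈I} f(□_i)⟩_1 = Σ_{Γ⊂I} ∫ds_Γ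
Σ_{π∈𝒫(Γ)} ⟨Π_{α∈π} [Σ_{ω(α)} ⟨δ/δΦ, C_s □Δ□ C_s ⋯ C_s(½ δ/δΦ + ℱ)⟩] Π_{i∈I} f(□_i)⟩_{s_Γ}"* with *"The 1/2 for the δ²/δΦ² term
compensates for the fact that we count a walk as being different from its reverse"*: each train STARTS in a `δ/δΦ` and ENDS *"in either δ/δΦ
or ℱ"*.  In the tree the train of a group `c` is p13's operator `BIJ88TrainPieces306.trainOp ℱ K G = ∂_{Kℱ}G + ½Σ_{p,q} K_{pq}∂_p∂_qG`,
`K = C𝔫(c)` (`wker`), and the product over the groups of a partition is `BIJ88WalkForm5133.trains` (the right side of p13's PROVED (5.13.3),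
instantiated on the located cube product by `BIJ88WalkFormLocated309`).  For the ESTIMATE of Sect. 5.13/5.14 (p. 307: *"Each time some □_i's
are joined, we have s-derivatives, which produce functional derivatives, chains of covariances C_{ω(α)} …"*) one needs that product written
out: THIS FILE proves

  `(Π_{k<m} 𝕋_{c_k}) G (φ) = Σ_{E} (Π_k coef_k(E_k)) · ∂_{e_{site(E)_{D(E)}}} G (φ)`,

the sum over the END DATA `E : Fin m → S ⊕ (S × S)` of the trains — train `k` ends in the source at the site `p` (`E_k = inl p`, one leg
`e_p`, coefficient `(K_kℱ)_p`) or in a second derivative at the sites `(p,q)` (`E_k = inr (p,q)`, legs `e_p, e_q`, coefficient `½(K_k)_{pq}`)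
— each term an ITERATED COORDINATE DERIVATIVE (p13's `BIJ88WickSourceSmooth305.dset`) of `G`, the object that
`BIJ88CubeProductDset306.dset_obs_eq_prod` / `BIJ88ProductRuleAllOrders306.dset_fD_uD_apply` distribute over cubes and slots.

statement-level skeleton of published theorems with citation tags; proofs where landed; nothing here is a claim about the Yang–Mills mass gap

PDF held: `paper:balaban1988-cmp114-bij-abelian-higgs-effective-action` (journal page = PDF page + 256); pages re-read this session as text:
PDF 50 (p. 306) via p13's headers (`BIJ88TrainPieces306`, `BIJ88WalkForm5133`), PDF 51 (p. 307) L2–5.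

CITATION HEADER (lean-in-tree rule).  Part of the lit-balaban TYPED SKELETON (HOME `run/shared/lean/pub/lit-balaban/`), Phase 2, seat p36
(gen 21, unit `lit-balaban-p36`); rows **C2.Eq5.14.3-5.14.4** (member: §f brick 9 — the trains of `BIJ88WalkFormLocated309` as explicit
sums of coordinate `dset`s with kernel coefficients, the input of bricks 7–8) and C2.Eq5.13.3-5.13.4 (member: calculus of p13's `trains`)
of `HOME/lit-balaban-r16/ROWS-C2-part2.md`.
WHAT IS REPRODUCED (definitions WITH BODIES — the end data bookkeeping — and theorems; no `Prop` facts; axioms standard):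
* §1 `legsAt`, `trainLegs`, `trainSite`, `trainCoef` (the legs in `Fin m ×ₗ Fin 2`, their sites and the coefficient of an end datum `E`),
  `legShift` (`legShift_strictMono`, `lt_legShift`) and their `Fin.cons` recursions (`legsAt_succ`, `trainLegs_cons`, `trainSite_cons_shift`,
  `trainSite_cons_zero`, `trainCoef_cons`);
* §2 `dset_map_strictMono` (re-indexing the legs of p13's `dset` along a strictly monotone map), `fderiv_sum_mul_apply`;
* §3 **`trains_ofFn_eq_sum_dset`** — the display (as an identity of functions of the field), for `G ∈ C_b^∞` and a tuple of groups —
  with the pointwise forms `trains_ofFn_apply` and **`trains_apply_eq_sum_dset`** (a LIST of groups, trains indexed by positions, as in the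
  `P.toList` of `BIJ88WalkFormLocated309`).
HONEST SCOPE.  An identity; no estimate (the decay of the kernels `K_k = C𝔫(c_k)` and the counting of the end data are the successor's).
-/

namespace Literature.MathematicalPhysics.QuantumFieldTheory.BalabanImbrieJaffe1984to88.BIJ88TrainsDsetExpansion306

open Finset Function Matrix
open scoped BigOperators
open BIJ88WickSourceSmooth305 (dset dset_empty dset_insert_max)
open BIJ88SmoothClassCalculus306 (dset_insert_min fderiv_eq_sum_single)
open BIJ88SmoothFactors5133 (CbInf)
open BIJ88TrainPieces306 (wker trainOp D2)
open BIJ88WalkForm5133 (trains trains_nil trains_cons)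
open BIJ88ProductRuleAllOrders306 (cbInf_dset)

variable {S : Type} [Fintype S] [DecidableEq S]

/-! ## §1 End data of a product of trains: legs, sites, coefficients -/

section EndData

/-- the legs of train `k` with end `e`: the inner leg `(k,1)` always; the outer leg `(k,0)` when the train ends in a second derivative.
[cite: BalabanImbrieJaffe1988, §5.13 Eq. (5.13.3) p.306] -/
def legsAt {m : ℕ} (k : Fin m) (e : S ⊕ (S × S)) : Finset (Fin m ×ₗ Fin 2) :=
  Sum.elim (fun _ => {toLex (k, 1)}) (fun _ => {toLex (k, 0), toLex (k, 1)}) e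

/-- the legs of the end data `E` of `m` trains. [cite: BalabanImbrieJaffe1988, §5.13 Eq. (5.13.3) p.306] -/
def trainLegs {m : ℕ} (E : Fin m → S ⊕ (S × S)) : Finset (Fin m ×ₗ Fin 2) :=
  Finset.univ.biUnion fun k => legsAt k (E k)

/-- the site of a leg: `p` for a source end `inl p`; `p` (outer leg) resp. `q` (inner leg) for a second-derivative end `inr (p,q)`.
[cite: BalabanImbrieJaffe1988, §5.13 Eq. (5.13.3) p.306] -/
def trainSite {m : ℕ} (E : Fin m → S ⊕ (S × S)) (j : Fin m ×ₗ Fin 2) : S :=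
  Sum.elim (fun p => p) (fun pq => if (ofLex j).2 = 0 then pq.1 else pq.2) (E (ofLex j).1)

/-- the coefficient of the end data: `(K_kℱ)_p` for a source end, `½(K_k)_{pq}` for a second-derivative end (*"The 1/2 for the δ²/δΦ² term
compensates for the fact that we count a walk as being different from its reverse"*), multiplied over the trains.
[cite: BalabanImbrieJaffe1988, §5.13 Eq. (5.13.3) p.306] -/
noncomputable def trainCoef {m : ℕ} (f : S → ℝ) (K : Fin m → Matrix S S ℝ) (E : Fin m → S ⊕ (S × S)) : ℝ :=
  ∏ k, Sum.elim (fun p => (K k *ᵥ f) p) (fun pq => (1 / 2 : ℝ) * K k pq.1 pq.2) (E k)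

/-- shifting the train index by one (the legs of the tail trains inside a longer product). [cite: BalabanImbrieJaffe1988, §5.13 Eq. (5.13.3) p.306] -/
def legShift (m : ℕ) (j : Fin m ×ₗ Fin 2) : Fin (m + 1) ×ₗ Fin 2 := toLex ((ofLex j).1.succ, (ofLex j).2)

/-- the shift is strictly monotone for the lexicographic order. [cite: BalabanImbrieJaffe1988, §5.13 Eq. (5.13.3) p.306] -/
theorem legShift_strictMono (m : ℕ) : StrictMono (legShift m) := by
  intro j j' h
  have h' : toLex (ofLex j) < toLex (ofLex j') := by simpa using h
  rw [Prod.Lex.toLex_lt_toLex] at h'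
  show toLex ((ofLex j).1.succ, (ofLex j).2) < toLex ((ofLex j').1.succ, (ofLex j').2)
  rw [Prod.Lex.toLex_lt_toLex]
  rcases h' with h1 | ⟨h1, h2⟩
  · exact Or.inl (Fin.succ_lt_succ_iff.2 h1)
  · exact Or.inr ⟨by rw [h1], h2⟩

omit [Fintype S] [DecidableEq S] in
/-- the legs of a shifted train are the shifted legs. [cite: BalabanImbrieJaffe1988, §5.13 Eq. (5.13.3) p.306] -/
theorem legsAt_succ {m : ℕ} (k : Fin m) (e : S ⊕ (S × S)) :
    legsAt k.succ e = (legsAt k e).map ⟨legShift m, (legShift_strictMono m).injective⟩ := by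
  rcases e with p | pq
  · simp [legsAt, legShift]
  · simp [legsAt, legShift, Finset.map_insert]

omit [Fintype S] [DecidableEq S] in
/-- **legs of a product with one more train in front**: the new train's legs and the shifted old ones.
[cite: BalabanImbrieJaffe1988, §5.13 Eq. (5.13.3) p.306] -/
theorem trainLegs_cons {m : ℕ} (e : S ⊕ (S × S)) (E : Fin m → S ⊕ (S × S)) :
    trainLegs (Fin.cons e E : Fin (m + 1) → S ⊕ (S × S)) =
      legsAt 0 e ∪ (trainLegs E).map ⟨legShift m, (legShift_strictMono m).injective⟩ := by
  rw [trainLegs, Fin.univ_succ, Finset.cons_eq_insert, Finset.biUnion_insert, Fin.cons_zero, Finset.map_eq_image,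
    Finset.image_biUnion, trainLegs, Finset.map_eq_image, Finset.biUnion_image]
  congr 1
  refine Finset.biUnion_congr rfl fun k _ => ?_
  simp only [Function.Embedding.coeFn_mk, Fin.cons_succ, legsAt_succ, Finset.map_eq_image]

/-- the shifted legs all lie above the new train's legs. [cite: BalabanImbrieJaffe1988, §5.13 Eq. (5.13.3) p.306] -/
theorem lt_legShift {m : ℕ} (b : Fin 2) (j : Fin m ×ₗ Fin 2) : toLex ((0 : Fin (m + 1)), b) < legShift m j := by
  show toLex ((0 : Fin (m + 1)), b) < toLex ((ofLex j).1.succ, (ofLex j).2)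
  rw [Prod.Lex.toLex_lt_toLex]
  exact Or.inl (Fin.succ_pos _)

omit [Fintype S] [DecidableEq S] in
/-- sites of shifted legs. [cite: BalabanImbrieJaffe1988, §5.13 Eq. (5.13.3) p.306] -/
theorem trainSite_cons_shift {m : ℕ} (e : S ⊕ (S × S)) (E : Fin m → S ⊕ (S × S)) (j : Fin m ×ₗ Fin 2) :
    trainSite (Fin.cons e E : Fin (m + 1) → S ⊕ (S × S)) (legShift m j) = trainSite E j := by
  simp only [trainSite, legShift, ofLex_toLex, Fin.cons_succ]
  rfl

omit [Fintype S] [DecidableEq S] in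
/-- sites of the new train's legs. [cite: BalabanImbrieJaffe1988, §5.13 Eq. (5.13.3) p.306] -/
theorem trainSite_cons_zero {m : ℕ} (e : S ⊕ (S × S)) (E : Fin m → S ⊕ (S × S)) (b : Fin 2) :
    trainSite (Fin.cons e E : Fin (m + 1) → S ⊕ (S × S)) (toLex (0, b)) =
      Sum.elim (fun p => p) (fun pq => if b = 0 then pq.1 else pq.2) e := by
  simp only [trainSite, ofLex_toLex, Fin.cons_zero]
  rfl

omit [DecidableEq S] in
/-- **coefficient of a product with one more train in front**. [cite: BalabanImbrieJaffe1988, §5.13 Eq. (5.13.3) p.306] -/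
theorem trainCoef_cons {m : ℕ} (f : S → ℝ) (K₀ : Matrix S S ℝ) (K : Fin m → Matrix S S ℝ) (e : S ⊕ (S × S))
    (E : Fin m → S ⊕ (S × S)) :
    trainCoef f (Fin.cons K₀ K : Fin (m + 1) → Matrix S S ℝ) (Fin.cons e E : Fin (m + 1) → S ⊕ (S × S)) =
      Sum.elim (fun p => (K₀ *ᵥ f) p) (fun pq => (1 / 2 : ℝ) * K₀ pq.1 pq.2) e * trainCoef f K E := by
  rw [trainCoef, Fin.prod_univ_succ, Fin.cons_zero, Fin.cons_zero]
  simp only [Fin.cons_succ]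
  rfl

end EndData

/-! ## §2 Re-indexing the legs of `dset`; derivatives of finite sums -/

section Calculus

omit [Fintype S] [DecidableEq S] in
/-- **re-indexing the legs** of p13's iterated derivative along a strictly monotone map of the index type:
`∂_{u'_{e(D)}} G = ∂_{(u' ∘ e)_D} G`. [cite: BalabanImbrieJaffe1988, §5.13 p.306] -/
theorem dset_map_strictMono {κ κ' : Type} [LinearOrder κ] [LinearOrder κ'] {e : κ → κ'} (he : StrictMono e)
    (u' : κ' → S → ℝ) (D : Finset κ) (G : (S → ℝ) → ℝ) :
    dset u' (D.map ⟨e, he.injective⟩) G = dset (u' ∘ e) D G := by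
  induction D using Finset.induction_on_max generalizing G with
  | empty => rw [Finset.map_empty, dset_empty, dset_empty]
  | insert a s ha ih =>
    have ha' : ∀ x ∈ s.map ⟨e, he.injective⟩, x < e a := by
      intro x hx
      obtain ⟨y, hy, rfl⟩ := Finset.mem_map.1 hx
      exact he (ha y hy)
    rw [Finset.map_insert, Function.Embedding.coeFn_mk, dset_insert_max u' ha', ih, dset_insert_max _ ha]
    rfl

omit [DecidableEq S] in
/-- the directional derivative of a finite combination of differentiable factors. [cite: BalabanImbrieJaffe1988, §5.13 p.306] -/
theorem fderiv_sum_mul_apply {ι : Type*} (s : Finset ι) (c : ι → ℝ) {h : ι → (S → ℝ) → ℝ} {φ : S → ℝ}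
    (hd : ∀ i ∈ s, DifferentiableAt ℝ (h i) φ) (v : S → ℝ) :
    fderiv ℝ (fun ψ => ∑ i ∈ s, c i * h i ψ) φ v = ∑ i ∈ s, c i * fderiv ℝ (h i) φ v := by
  have H : HasFDerivAt (fun ψ => ∑ i ∈ s, c i * h i ψ) (∑ i ∈ s, c i • fderiv ℝ (h i) φ) φ :=
    HasFDerivAt.fun_sum fun i hi => ((hd i hi).hasFDerivAt).const_mul (c i)
  rw [H.fderiv]
  simp only [_root_.sum_apply, _root_.smul_apply, smul_eq_mul]

end Calculus

/-! ## §3 The product of trains expanded over the end data -/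

section Expansion

variable {I : Type} [DecidableEq I] (f : S → ℝ) (C : Matrix S S ℝ) (N : Finset I → Matrix S S ℝ)

/-- **THE PRODUCT OF TRAINS AS A SUM OVER END DATA OF ITERATED COORDINATE DERIVATIVES** ((5.13.3): each train *"ending in either δ/δΦ or
ℱ"*): for `G ∈ C_b^∞` and groups `c_0, …, c_{m−1}` with kernels `K_k = C𝔫(c_k)`,
`(𝕋_{c_0} ∘ ⋯ ∘ 𝕋_{c_{m−1}}) G = Σ_{E : Fin m → S ⊕ (S×S)} trainCoef(E) · ∂_{e_{trainSite E}, trainLegs E} G`.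
[cite: BalabanImbrieJaffe1988, §5.13 Eq. (5.13.3) p.306] -/
theorem trains_ofFn_eq_sum_dset {G : (S → ℝ) → ℝ} (hG : CbInf G) :
    ∀ (m : ℕ) (Lc : Fin m → Finset (Finset I)),
      trains f C N (List.ofFn Lc) G = fun φ => ∑ E : Fin m → S ⊕ (S × S),
        trainCoef f (fun k => C * wker C N (Lc k)) E *
          dset (fun j => Pi.single (trainSite E j) (1 : ℝ)) (trainLegs E) G φ := by
  intro m
  induction m with
  | zero =>
    intro Lc
    funext φ
    rw [List.ofFn_zero, trains_nil, Fintype.sum_unique]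
    have hlegs : trainLegs (default : Fin 0 → S ⊕ (S × S)) = ∅ := by simp [trainLegs]
    rw [hlegs, dset_empty, trainCoef, Fintype.prod_empty, one_mul]
  | succ m ih =>
    intro Lc
    funext φ
    rw [List.ofFn_succ, trains_cons, ih (fun i => Lc i.succ)]
    -- abbreviations for the tail expansion
    set K₀ : Matrix S S ℝ := C * wker C N (Lc 0) with hK₀
    set K : Fin m → Matrix S S ℝ := fun k => C * wker C N (Lc k.succ) with hK
    set H : (Fin m → S ⊕ (S × S)) → (S → ℝ) → ℝ := fun E =>
      dset (fun j => Pi.single (trainSite E j) (1 : ℝ)) (trainLegs E) G with hH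
    have hHc : ∀ E, CbInf (H E) := fun E => cbInf_dset _ _ hG
    have hHd : ∀ E ψ, DifferentiableAt ℝ (H E) ψ := fun E ψ => ((hHc E).1.differentiable (by simp)) ψ
    have hH1c : ∀ E (q : S), CbInf fun ψ => fderiv ℝ (H E) ψ (Pi.single q 1) := fun E q => (hHc E).fderiv_apply _
    -- the new train acting on the tail expansion
    have step : trainOp f K₀ (fun φ => ∑ E : Fin m → S ⊕ (S × S), trainCoef f K E * H E φ) φ =
        ∑ p, (K₀ *ᵥ f) p * ∑ E : Fin m → S ⊕ (S × S), trainCoef f K E * fderiv ℝ (H E) φ (Pi.single p 1) +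
        ∑ p, ∑ q, (1 / 2 : ℝ) * K₀ p q * ∑ E : Fin m → S ⊕ (S × S), trainCoef f K E *
          fderiv ℝ (fun ψ => fderiv ℝ (H E) ψ (Pi.single q 1)) φ (Pi.single p 1) := by
      rw [trainOp, fderiv_eq_sum_single]
      congr 1
      · refine Finset.sum_congr rfl fun p _ => ?_
        rw [fderiv_sum_mul_apply _ _ (fun E _ => hHd E φ)]
      · rw [Finset.mul_sum]
        refine Finset.sum_congr rfl fun p _ => ?_
        rw [Finset.mul_sum]
        refine Finset.sum_congr rfl fun q _ => ?_
        rw [D2, mul_assoc]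
        congr 1
        have h1 : (fun ψ => fderiv ℝ (fun ψ' => ∑ E : Fin m → S ⊕ (S × S), trainCoef f K E * H E ψ') ψ (Pi.single q 1)) =
            fun ψ => ∑ E : Fin m → S ⊕ (S × S), trainCoef f K E * fderiv ℝ (H E) ψ (Pi.single q 1) :=
          funext fun ψ => fderiv_sum_mul_apply _ _ (fun E _ => hHd E ψ) _
        rw [h1, fderiv_sum_mul_apply _ _ (fun E _ => ((hH1c E q).1.differentiable (by simp)) φ)]
    rw [step]
    -- the right side split over the end of the new train
    symm
    rw [← (Fin.consEquiv fun _ : Fin (m + 1) => S ⊕ (S × S)).sum_comp, Fintype.sum_prod_type, Fintype.sum_sum_type,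
      Fintype.sum_prod_type]
    have hKc : (fun k : Fin (m + 1) => C * wker C N (Lc k)) = Fin.cons K₀ K := by
      funext k; refine Fin.cases ?_ (fun i => ?_) k
      · rw [Fin.cons_zero]
      · rw [Fin.cons_succ]
    -- the new train's legs differentiate the tail term last (outermost)
    have hshift : ∀ (e : S ⊕ (S × S)) (E : Fin m → S ⊕ (S × S)),
        dset (fun j => Pi.single (trainSite (Fin.cons e E : Fin (m + 1) → S ⊕ (S × S)) j) (1 : ℝ))
          ((trainLegs E).map ⟨legShift m, (legShift_strictMono m).injective⟩) G = H E := by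
      intro e E
      rw [dset_map_strictMono (legShift_strictMono m), hH]
      exact BIJ88SmoothClassCalculus306.dset_congr (fun j _ => by
        simp only [Function.comp_apply, trainSite_cons_shift]) G
    have hlt1 : ∀ (e : S ⊕ (S × S)) (E : Fin m → S ⊕ (S × S)) (b : Fin 2),
        ∀ x ∈ (trainLegs E).map ⟨legShift m, (legShift_strictMono m).injective⟩, toLex ((0 : Fin (m + 1)), b) < x := by
      intro e E b x hx
      obtain ⟨y, _, rfl⟩ := Finset.mem_map.1 hx
      exact lt_legShift b y
    congr 1
    · refine Finset.sum_congr rfl fun p _ => ?_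
      rw [Finset.mul_sum]
      refine Finset.sum_congr rfl fun E _ => ?_
      have hterm : dset (fun j => Pi.single (trainSite (Fin.cons (Sum.inl p) E : Fin (m + 1) → S ⊕ (S × S)) j) (1 : ℝ))
          (trainLegs (Fin.cons (Sum.inl p) E : Fin (m + 1) → S ⊕ (S × S))) G φ = fderiv ℝ (H E) φ (Pi.single p 1) := by
        rw [trainLegs_cons, show legsAt (0 : Fin (m + 1)) (Sum.inl p : S ⊕ (S × S)) = {toLex (0, 1)} from rfl,
          Finset.singleton_union, dset_insert_min _ (hlt1 (Sum.inl p) E 1), hshift, trainSite_cons_zero]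
        rfl
      rw [show (Fin.consEquiv fun _ : Fin (m + 1) => S ⊕ (S × S)) (Sum.inl p, E) = Fin.cons (Sum.inl p) E from rfl, hKc,
        trainCoef_cons, hterm]
      simp only [Sum.elim_inl]
      ring
    · refine Finset.sum_congr rfl fun p _ => Finset.sum_congr rfl fun q _ => ?_
      rw [Finset.mul_sum]
      refine Finset.sum_congr rfl fun E _ => ?_
      have hterm : dset (fun j => Pi.single (trainSite (Fin.cons (Sum.inr (p, q)) E : Fin (m + 1) → S ⊕ (S × S)) j) (1 : ℝ))
          (trainLegs (Fin.cons (Sum.inr (p, q)) E : Fin (m + 1) → S ⊕ (S × S))) G φ =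
            fderiv ℝ (fun ψ => fderiv ℝ (H E) ψ (Pi.single q 1)) φ (Pi.single p 1) := by
        have h01 : ∀ x ∈ insert (toLex ((0 : Fin (m + 1)), (1 : Fin 2)))
            ((trainLegs E).map ⟨legShift m, (legShift_strictMono m).injective⟩), toLex ((0 : Fin (m + 1)), (0 : Fin 2)) < x := by
          intro x hx
          rcases Finset.mem_insert.1 hx with rfl | hx
          · rw [Prod.Lex.toLex_lt_toLex]; exact Or.inr ⟨rfl, by show (0 : Fin 2) < 1; decide⟩
          · exact hlt1 (Sum.inr (p, q)) E 0 x hx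
        rw [trainLegs_cons, show legsAt (0 : Fin (m + 1)) (Sum.inr (p, q) : S ⊕ (S × S)) = {toLex (0, 0), toLex (0, 1)} from rfl,
          Finset.insert_union, Finset.singleton_union, dset_insert_min _ h01, dset_insert_min _ (hlt1 (Sum.inr (p, q)) E 1), hshift,
          trainSite_cons_zero, trainSite_cons_zero]
        rfl
      rw [show (Fin.consEquiv fun _ : Fin (m + 1) => S ⊕ (S × S)) (Sum.inr (p, q), E) = Fin.cons (Sum.inr (p, q)) E from rfl, hKc,
        trainCoef_cons, hterm]
      simp only [Sum.elim_inr]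
      ring

/-- pointwise form. [cite: BalabanImbrieJaffe1988, §5.13 Eq. (5.13.3) p.306] -/
theorem trains_ofFn_apply {G : (S → ℝ) → ℝ} (hG : CbInf G) (m : ℕ) (Lc : Fin m → Finset (Finset I)) (φ : S → ℝ) :
    trains f C N (List.ofFn Lc) G φ = ∑ E : Fin m → S ⊕ (S × S),
      trainCoef f (fun k => C * wker C N (Lc k)) E * dset (fun j => Pi.single (trainSite E j) (1 : ℝ)) (trainLegs E) G φ := by
  rw [trains_ofFn_eq_sum_dset f C N hG m Lc]

/-- the same for a LIST of groups (as in `BIJ88WalkFormLocated309`: `P.toList`), indexing the trains by the positions in the list.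
[cite: BalabanImbrieJaffe1988, §5.13 Eq. (5.13.3) p.306] -/
theorem trains_apply_eq_sum_dset {G : (S → ℝ) → ℝ} (hG : CbInf G) (L : List (Finset (Finset I))) (φ : S → ℝ) :
    trains f C N L G φ = ∑ E : Fin L.length → S ⊕ (S × S),
      trainCoef f (fun k => C * wker C N (L.get k)) E * dset (fun j => Pi.single (trainSite E j) (1 : ℝ)) (trainLegs E) G φ := by
  conv_lhs => rw [← List.ofFn_get L]
  exact trains_ofFn_apply f C N hG L.length L.get φ

end Expansion

end Literature.MathematicalPhysics.QuantumFieldTheory.BalabanImbrieJaffe1984to88.BIJ88TrainsDsetExpansion306
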